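import Summits.KontsevichZagierPeriods.KontsevichZagierPeriods.Theses.ZeroPortrait
import Summits.KontsevichZagierPeriods.KontsevichZagierPeriods.Theses.LiftingCriteria
import Summits.KontsevichZagierPeriods.KontsevichZagierPeriods.Theorems.FurushoPentagonSectorToKernelCubeResolutionOfNash
import Summits.KontsevichZagierPeriods.KontsevichZagierPeriods.Theorems.HurwitzMicroSectorsNormalFormPrincipleSplitGlue
import Summits.KontsevichZagierPeriods.KontsevichZagierPeriods.Theorems.TerasomaMultiplicationBetaCancellationOfAyoubPiCancellation
import Literature.NumberTheory.Transcendental.KZCalculusProofs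
import Literature.NumberTheory.Transcendental.KZProductIdeal

/-!
# `ZeroPortrait.PencilComplete` (stmt-KontsevichZagierPeriods-11731) from its three split children:
the Ayoub–π split modulo the pencil sector, assembled

Route ZeroPortrait, crux `PencilComplete` (Conjecture 1 with KZ-literal rational endpoints RELATIVE to the
two ℚ-pencils of the route: `[ρ] − [ρ'] ∈ pencilSector := relations ⊔ closure(equal-valued Legendre-pencil
pairs) ⊔ closure(equal-valued beta-pencil pairs)`), decomposed by the crux strategist
(`cstrat-stmt-KontsevichZagierPeriods-11731-r1`, 2026-08-17; `Cruxes/PencilComplete/STRATEGY-CENSUS.md`,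
`AyoubPiSplit.lean`; the `route edit --split` itself is deferred by gate policy to the seat's final cycle)
into three leaves

* `LiftingCriteria.CubeNashNormalForm` — leaf 1, the cube–Nash NORMAL FORM (= item 3574,
  shared with DimensionBudget / SymplecticScissors); summit-free geometry
  [Ayoub 2014, Rem. 12–13; Huber–Müller-Stach 2017, Lemma 11.2.3];
* `CubicalPiLocalKernelModPencils` (this file, `@[conjecture]`) — leaf 2, Ayoub's effective cube kernel LOCALISED at the
  disc class and taken modulo the pencil sector [Kontsevich–Zagier 2001 §4.1; Ayoub 2014, Conj. 7];
* `PiCancellationModPencils` (this file, `@[conjecture]`) — leaf 3, `[π]`-cancellation modulo the pencil sector (item 0540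
  with `relations ↦ pencilSector`) [Huber–Wüstholz 2022, App. A.4].

Main result `pencilComplete_of_subs : CubeNashNormalForm → CubicalPiLocalKernelModPencils →
PiCancellationModPencils → PencilComplete` (sorry-free): rational equal-valued pair → `c = [ρ] − [ρ']`,
`eval c = 0` → cubical resolution of `c` from leaf 1 (`SectorToKernel.cubeResolution_of_cubeNashNormalForm`,
landed) → a value-zero element `a` of the cubical span (soundness) → a pinned disc-product operator EXISTS
(`NormalFormPrincipleSplitGlue.exists_pinnedProduct`, landed) → leaf 2 gives `[π]^N a ∈ pencilSector` →
leaf 3 peels the `N` disc factors (induction) → `c ∈ pencilSector`.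
Honesty certificates (all proved): the summit implies the crux (`pencilComplete_of_summit`); the crux is
equivalent to its kernel form `ker eval ≤ pencilSector` (`pencilComplete_iff_kernelForm`); the crux implies
leaves 2 and 3 (`cubicalPiLocalKernelModPencils_of_crux`, `piCancellationModPencils_of_crux`), so neither is
stronger than the crux; given leaf 1 the split is exact (`pencilComplete_iff_piSplit_of_cubeNash`).
The two `Prop` definitions are OPEN conjectures of our theories (`@[conjecture]`, obligation nodes by name —
never vendored facts; crux-implied, so refuting either refutes the summit); every other declaration is a
definition with a body or a proved theorem; no named fact is introduced.

References: Kontsevich–Zagier 2001 §1.2, §4.1; Ayoub, EMS Newsl. 91 (2014) Def. 9–10, Prop. 11, Rem. 12–13,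
Conj. 7; Huber–Wüstholz 2022 App. A.4; Huber–Müller-Stach 2017 Lemma 11.2.3, Rem. 13.1.8.
-/

noncomputable section

-- `Summit.KontsevichZagierPeriods.KontsevichZagierPeriods.…` is the tree's mandated layout (single-conjunct summit).
set_option linter.dupNamespace false

namespace Summit.KontsevichZagierPeriods.KontsevichZagierPeriods.ZeroPortraitPencilCompleteSplit

open MeasureTheory Set
open Literature.NumberTheory.Transcendental
open Literature.NumberTheory.Transcendental.KZ hiding cubicalSpan
open Summit.KontsevichZagierPeriods.KontsevichZagierPeriods.Theses.ZeroPortrait (PencilComplete)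
open Summit.KontsevichZagierPeriods.KontsevichZagierPeriods.Theses.LiftingCriteria (CubeNashNormalForm)
open Summit.KontsevichZagierPeriods.FurushoPentagon.ReducedPeriodRing (cubicalGens cubicalSpan)
open Summit.KontsevichZagierPeriods.FurushoPentagon.SectorToKernel (cubeResolution_of_cubeNashNormalForm)
open Summit.KontsevichZagierPeriods.HurwitzMicroSectors.NormalFormPrincipleSplitGlue (exists_pinnedProduct)
open Summit.KontsevichZagierPeriods.KontsevichZagierPeriods.BetaCancellationLine (piRep_mul_sub_lift_mem_relations)

/-! ## The route's vocabulary, named -/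

/-- Equal-valued Legendre-pencil pair differences (route ZeroPortrait, verbatim). [cite: KontsevichZagier2001, §1.2] -/
def legendrePairs : Set FormalRep :=
  {d | ∃ (a b c s : ℚ) (r : Literature.NumberTheory.Transcendental.KZ.IntegralRep 2) (r' : Literature.NumberTheory.Transcendental.KZ.IntegralRep 1), 0 < s ∧ s < 1 ∧ r.domain = {x | ∀ i, x i ∈ Set.Ioo (0:ℝ) 1} ∧ Set.EqOn r.integrand (fun x => (a : ℝ) * (1 / Real.sqrt ((1 - x 0 ^ 2) * (1 - (s : ℝ) * x 0 ^ 2)) * (1 / Real.sqrt ((1 - x 1 ^ 2) * (1 - (s : ℝ) * x 1 ^ 2)))) + (b : ℝ) * (Real.sqrt (1 - (s : ℝ) * x 0 ^ 2) / Real.sqrt (1 - x 0 ^ 2) * (1 / Real.sqrt ((1 - x 1 ^ 2) * (1 - (s : ℝ) * x 1 ^ 2)))) + (c : ℝ) * (Real.sqrt (1 - (s : ℝ) * x 0 ^ 2) / Real.sqrt (1 - x 0 ^ 2) * (Real.sqrt (1 - (s : ℝ) * x 1 ^ 2) / Real.sqrt (1 - x 1 ^ 2)))) r.domain ∧ r'.domain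 = Set.univ ∧ Set.EqOn r'.integrand (fun x => 1 / (2 * (1 + x 0 ^ 2))) r'.domain ∧ r.value = r'.value ∧ d = Literature.NumberTheory.Transcendental.KZ.of r - Literature.NumberTheory.Transcendental.KZ.of r'}

/-- Equal-valued beta-pencil pair differences (route ZeroPortrait, verbatim). [cite: KontsevichZagier2001, §1.2] -/
def betaPairs : Set FormalRep :=
  {d | ∃ (s : ℚ) (r r' : Literature.NumberTheory.Transcendental.KZ.IntegralRep 2), 0 < s ∧ r.domain = {x | ∀ i, x i ∈ Set.Ioo (0:ℝ) 1} ∧ Set.EqOn r.integrand (fun x => (x 0) ^ ((s : ℝ) - 1) * (1 - x 0) ^ (-(5:ℝ)/9) * (x 1) ^ (-(4:ℝ)/9) * (1 - x 1) ^ (-(2:ℝ)/9)) r.domain ∧ r'.domain = {x | x 0 ^ 2 + x 1 ^ 2 < 4} ∧ Set.EqOn r'.integrand (fun _ => (3:ℝ) ^ ((7:ℝ)/6) / 2) r'.domain ∧ r.value = r'.value ∧ d = Literature.NumberTheory.Transcendental.KZ.of r - Literature.NumberTheory.Transcendental.KZ.of r'}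

/-- The pencil sector `relations ⊔ closure legendrePairs ⊔ closure betaPairs` of route ZeroPortrait.
[cite: KontsevichZagier2001, §1.2] -/
def pencilSector : AddSubgroup FormalRep :=
  relations ⊔ AddSubgroup.closure legendrePairs ⊔ AddSubgroup.closure betaPairs

/-- The additive extension `[r] ↦ [P r]` of a disc-product operator to formal combinations (the `liftP` of
items 0540/0541). [cite: KontsevichZagier2001, §4.1] -/
def liftP (P : ∀ n : ℕ, IntegralRep n → IntegralRep (n + 2)) : FormalRep →+ FormalRep :=
  FreeAbelianGroup.lift (fun s : (Σ n, IntegralRep n) => of (P s.1 s.2))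

/-! ## The two new leaves of the split (open conjectures of our theories, obligation nodes by name;
the route children `ZeroPortrait.CubicalPiLocalKernelModPencils` / `.PiCancellationModPencils` of the deferred
`route edit --split` carry these statements verbatim) -/

/-- **LEAF 2 — Ayoub's effective cube kernel, LOCALISED at `[π]`, MODULO the pencil sector**: for every pinned
disc-product operator `P` and every `a` in the span of tame cube classes with `eval a = 0`, some iterate
`(liftP P)^[N] a` lies in `pencilSector`. Crux-implied (`N = 0`, `cubicalPiLocalKernelModPencils_of_crux`), hence
summit-implied; it carries the transcendence content of the crux off the two pencils (GPC-strength). The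
pencil-relative form of `Literature.NumberTheory.Transcendental.KZ.PiLocalKernel` restricted to Ayoub's
presentation. [cite: Ayoub2014, Def. 6 and Conj. 7] [cite: KontsevichZagier2001, §4.1] [status: open] -/
@[conjecture] def CubicalPiLocalKernelModPencils : Prop :=
  ∀ (P : ∀ n : ℕ, Literature.NumberTheory.Transcendental.KZ.IntegralRep n → Literature.NumberTheory.Transcendental.KZ.IntegralRep (n + 2)), (∀ (n : ℕ) (r : Literature.NumberTheory.Transcendental.KZ.IntegralRep n), (P n r).domain = {z : Fin (n + 2) → ℝ | z 0 ^ 2 + z 1 ^ 2 ≤ 1 ∧ (fun i : Fin n => z i.succ.succ) ∈ r.domain} ∧ (P n r).integrand = fun z => r.integrand (fun i : Fin n => z i.succ.succ)) → ∀ a ∈ AddSubgroup.closure {d : Literature.NumberTheory.Transcendental.KZ.FormalRep | ∃ (n : ℕ) (ρ : Literature.NumberTheory.Transcendental.KZ.IntegralRep n), ρ.domain = {x | ∀ i, 0 ≤ x i ∧ x i ≤ 1} ∧ AnalyticOnNhd ℝ ρ.integrand {x | ∀ i, 0 ≤ x i ∧ x i ≤ 1} ∧ d = Literature.NumberTheory.Transcendental.KZ.of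 ρ}, Literature.NumberTheory.Transcendental.KZ.eval a = 0 → ∃ N : ℕ, (⇑(FreeAbelianGroup.lift (fun s : (Σ n, Literature.NumberTheory.Transcendental.KZ.IntegralRep n) => Literature.NumberTheory.Transcendental.KZ.of (P s.1 s.2))))^[N] a ∈ (Literature.NumberTheory.Transcendental.KZ.relations ⊔ AddSubgroup.closure {d | ∃ (a b c s : ℚ) (r : Literature.NumberTheory.Transcendental.KZ.IntegralRep 2) (r' : Literature.NumberTheory.Transcendental.KZ.IntegralRep 1), 0 < s ∧ s < 1 ∧ r.domain = {x | ∀ i, x i ∈ Set.Ioo (0:ℝ) 1} ∧ Set.EqOn r.integrand (fun x => (a : ℝ) * (1 / Real.sqrt ((1 - x 0 ^ 2) * (1 - (s : ℝ) * x 0 ^ 2)) * (1 / Real.sqrt ((1 - x 1 ^ 2) * (1 - (s : ℝ) * x 1 ^ 2)))) + (b : ℝ) * (Real.sqrt (1 - (s : ℝ) * x 0 ^ 2) / Real.sqrt (1 - x 0 ^ 2) * (1 / Real.sqrt ((1 - x 1 ^ 2) * (1 - (s : ℝ) * x 1 ^ 2)))) + (c : ℝ) * (Real.sqrt (1 - (s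 : ℝ) * x 0 ^ 2) / Real.sqrt (1 - x 0 ^ 2) * (Real.sqrt (1 - (s : ℝ) * x 1 ^ 2) / Real.sqrt (1 - x 1 ^ 2)))) r.domain ∧ r'.domain = Set.univ ∧ Set.EqOn r'.integrand (fun x => 1 / (2 * (1 + x 0 ^ 2))) r'.domain ∧ r.value = r'.value ∧ d = Literature.NumberTheory.Transcendental.KZ.of r - Literature.NumberTheory.Transcendental.KZ.of r'} ⊔ AddSubgroup.closure {d | ∃ (s : ℚ) (r r' : Literature.NumberTheory.Transcendental.KZ.IntegralRep 2), 0 < s ∧ r.domain = {x | ∀ i, x i ∈ Set.Ioo (0:ℝ) 1} ∧ Set.EqOn r.integrand (fun x => (x 0) ^ ((s : ℝ) - 1) * (1 - x 0) ^ (-(5:ℝ)/9) * (x 1) ^ (-(4:ℝ)/9) * (1 - x 1) ^ (-(2:ℝ)/9)) r.domain ∧ r'.domain = {x | x 0 ^ 2 + x 1 ^ 2 < 4} ∧ Set.EqOn r'.integrand (fun _ => (3:ℝ) ^ ((7:ℝ)/6) / 2) r'.domain ∧ r.value = r'.value ∧ d = Literature.NumberTheory.Transcendental.KZ.of r - Literature.NumberTheory.Transcendental.KZ.of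 r'})

/-- **LEAF 3 — `[π]`-CANCELLATION MODULO the pencil sector**: for every pinned disc-product operator `P`,
`liftP P c ∈ pencilSector → c ∈ pencilSector` (item stmt-KontsevichZagierPeriods-0540 with
`relations ↦ pencilSector`). Transcendence-free, crux-implied (`piCancellationModPencils_of_crux`); its motivic
shadow — injectivity of `P̃(MM^eff) → P̃(MM)` — is printed as OPEN. [cite: HuberWustholz2022, App. A.4]
[cite: Ayoub2014, Conj. 7] [status: open] -/
@[conjecture] def PiCancellationModPencils : Prop :=
  ∀ (P : ∀ n : ℕ, Literature.NumberTheory.Transcendental.KZ.IntegralRep n → Literature.NumberTheory.Transcendental.KZ.IntegralRep (n + 2)), (∀ (n : ℕ) (r : Literature.NumberTheory.Transcendental.KZ.IntegralRep n), (P n r).domain = {z : Fin (n + 2) → ℝ | z 0 ^ 2 + z 1 ^ 2 ≤ 1 ∧ (fun i : Fin n => z i.succ.succ) ∈ r.domain} ∧ (P n r).integrand = fun z => r.integrand (fun i : Fin n => z i.succ.succ)) → ∀ c : Literature.NumberTheory.Transcendental.KZ.FormalRep, FreeAbelianGroup.lift (fun s : (Σ n, Literature.NumberTheory.Transcendental.KZ.IntegralRep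 n) => Literature.NumberTheory.Transcendental.KZ.of (P s.1 s.2)) c ∈ (Literature.NumberTheory.Transcendental.KZ.relations ⊔ AddSubgroup.closure {d | ∃ (a b c s : ℚ) (r : Literature.NumberTheory.Transcendental.KZ.IntegralRep 2) (r' : Literature.NumberTheory.Transcendental.KZ.IntegralRep 1), 0 < s ∧ s < 1 ∧ r.domain = {x | ∀ i, x i ∈ Set.Ioo (0:ℝ) 1} ∧ Set.EqOn r.integrand (fun x => (a : ℝ) * (1 / Real.sqrt ((1 - x 0 ^ 2) * (1 - (s : ℝ) * x 0 ^ 2)) * (1 / Real.sqrt ((1 - x 1 ^ 2) * (1 - (s : ℝ) * x 1 ^ 2)))) + (b : ℝ) * (Real.sqrt (1 - (s : ℝ) * x 0 ^ 2) / Real.sqrt (1 - x 0 ^ 2) * (1 / Real.sqrt ((1 - x 1 ^ 2) * (1 - (s : ℝ) * x 1 ^ 2)))) + (c : ℝ) * (Real.sqrt (1 - (s : ℝ) * x 0 ^ 2) / Real.sqrt (1 - x 0 ^ 2) * (Real.sqrt (1 - (s : ℝ) * x 1 ^ 2) / Real.sqrt (1 - x 1 ^ 2)))) r.domain ∧ r'.domain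 = Set.univ ∧ Set.EqOn r'.integrand (fun x => 1 / (2 * (1 + x 0 ^ 2))) r'.domain ∧ r.value = r'.value ∧ d = Literature.NumberTheory.Transcendental.KZ.of r - Literature.NumberTheory.Transcendental.KZ.of r'} ⊔ AddSubgroup.closure {d | ∃ (s : ℚ) (r r' : Literature.NumberTheory.Transcendental.KZ.IntegralRep 2), 0 < s ∧ r.domain = {x | ∀ i, x i ∈ Set.Ioo (0:ℝ) 1} ∧ Set.EqOn r.integrand (fun x => (x 0) ^ ((s : ℝ) - 1) * (1 - x 0) ^ (-(5:ℝ)/9) * (x 1) ^ (-(4:ℝ)/9) * (1 - x 1) ^ (-(2:ℝ)/9)) r.domain ∧ r'.domain = {x | x 0 ^ 2 + x 1 ^ 2 < 4} ∧ Set.EqOn r'.integrand (fun _ => (3:ℝ) ^ ((7:ℝ)/6) / 2) r'.domain ∧ r.value = r'.value ∧ d = Literature.NumberTheory.Transcendental.KZ.of r - Literature.NumberTheory.Transcendental.KZ.of r'}) → c ∈ (Literature.NumberTheory.Transcendental.KZ.relations ⊔ AddSubgroup.closure {d | ∃ (a b c s : ℚ) (r : Literature.NumberTheory.Transcendental.KZ.IntegralRep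 2) (r' : Literature.NumberTheory.Transcendental.KZ.IntegralRep 1), 0 < s ∧ s < 1 ∧ r.domain = {x | ∀ i, x i ∈ Set.Ioo (0:ℝ) 1} ∧ Set.EqOn r.integrand (fun x => (a : ℝ) * (1 / Real.sqrt ((1 - x 0 ^ 2) * (1 - (s : ℝ) * x 0 ^ 2)) * (1 / Real.sqrt ((1 - x 1 ^ 2) * (1 - (s : ℝ) * x 1 ^ 2)))) + (b : ℝ) * (Real.sqrt (1 - (s : ℝ) * x 0 ^ 2) / Real.sqrt (1 - x 0 ^ 2) * (1 / Real.sqrt ((1 - x 1 ^ 2) * (1 - (s : ℝ) * x 1 ^ 2)))) + (c : ℝ) * (Real.sqrt (1 - (s : ℝ) * x 0 ^ 2) / Real.sqrt (1 - x 0 ^ 2) * (Real.sqrt (1 - (s : ℝ) * x 1 ^ 2) / Real.sqrt (1 - x 1 ^ 2)))) r.domain ∧ r'.domain = Set.univ ∧ Set.EqOn r'.integrand (fun x => 1 / (2 * (1 + x 0 ^ 2))) r'.domain ∧ r.value = r'.value ∧ d = Literature.NumberTheory.Transcendental.KZ.of r - Literature.NumberTheory.Transcendental.KZ.of r'} ⊔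 AddSubgroup.closure {d | ∃ (s : ℚ) (r r' : Literature.NumberTheory.Transcendental.KZ.IntegralRep 2), 0 < s ∧ r.domain = {x | ∀ i, x i ∈ Set.Ioo (0:ℝ) 1} ∧ Set.EqOn r.integrand (fun x => (x 0) ^ ((s : ℝ) - 1) * (1 - x 0) ^ (-(5:ℝ)/9) * (x 1) ^ (-(4:ℝ)/9) * (1 - x 1) ^ (-(2:ℝ)/9)) r.domain ∧ r'.domain = {x | x 0 ^ 2 + x 1 ^ 2 < 4} ∧ Set.EqOn r'.integrand (fun _ => (3:ℝ) ^ ((7:ℝ)/6) / 2) r'.domain ∧ r.value = r'.value ∧ d = Literature.NumberTheory.Transcendental.KZ.of r - Literature.NumberTheory.Transcendental.KZ.of r'})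

/-- The crux, unfolded through the named sector. [folklore] -/
theorem pencilComplete_iff :
    PencilComplete ↔ ∀ ⦃n m : ℕ⦄ (ρ : IntegralRep n) (ρ' : IntegralRep m), ρ.IsRational → ρ'.IsRational →
      ρ.value = ρ'.value → of ρ - of ρ' ∈ pencilSector :=
  Iff.rfl

/-- Leaf 2, unfolded through the named vocabulary. [folklore] -/
theorem cubicalPiLocalKernelModPencils_iff :
    CubicalPiLocalKernelModPencils ↔
      ∀ (P : ∀ n : ℕ, IntegralRep n → IntegralRep (n + 2)),
        (∀ (n : ℕ) (r : IntegralRep n), (P n r).domain = {z : Fin (n + 2) → ℝ | z 0 ^ 2 + z 1 ^ 2 ≤ 1 ∧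
            (fun i : Fin n => z i.succ.succ) ∈ r.domain} ∧
          (P n r).integrand = fun z => r.integrand (fun i : Fin n => z i.succ.succ)) →
        ∀ a ∈ cubicalSpan, eval a = 0 → ∃ N : ℕ, (liftP P)^[N] a ∈ pencilSector :=
  Iff.rfl

/-- Leaf 3, unfolded through the named vocabulary. [folklore] -/
theorem piCancellationModPencils_iff :
    PiCancellationModPencils ↔
      ∀ (P : ∀ n : ℕ, IntegralRep n → IntegralRep (n + 2)),
        (∀ (n : ℕ) (r : IntegralRep n), (P n r).domain = {z : Fin (n + 2) → ℝ | z 0 ^ 2 + z 1 ^ 2 ≤ 1 ∧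
            (fun i : Fin n => z i.succ.succ) ∈ r.domain} ∧
          (P n r).integrand = fun z => r.integrand (fun i : Fin n => z i.succ.succ)) →
        ∀ c : FormalRep, liftP P c ∈ pencilSector → c ∈ pencilSector :=
  Iff.rfl

/-- `relations ≤ pencilSector`. [folklore] -/
theorem relations_le_pencilSector : relations ≤ pencilSector :=
  le_sup_left.trans le_sup_left

/-! ## The assembly -/

/-- Peeling: if `liftP P` reflects membership in the pencil sector, so do its iterates. [folklore] -/
theorem mem_pencilSector_of_iterate_mem {P : ∀ n : ℕ, IntegralRep n → IntegralRep (n + 2)}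
    (hcanc : ∀ c : FormalRep, liftP P c ∈ pencilSector → c ∈ pencilSector) :
    ∀ (N : ℕ) (x : FormalRep), (liftP P)^[N] x ∈ pencilSector → x ∈ pencilSector
  | 0, _, h => h
  | N + 1, x, h => by
    rw [Function.iterate_succ_apply'] at h
    exact mem_pencilSector_of_iterate_mem hcanc N x (hcanc _ h)

/-- **Cubical resolution of a formal combination**: under the cube–Nash normal form every formal combination
is congruent modulo the KZ relations to an element of the cubical span (landed
`cubeResolution_of_cubeNashNormalForm` on both halves of `exists_integralRep_sub`). [cite: Ayoub2014, Rem. 12] -/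
theorem exists_cubical_of_cubeNashNormalForm (h₁ : CubeNashNormalForm) (c : FormalRep) :
    ∃ a ∈ cubicalSpan, c - a ∈ relations := by
  obtain ⟨n, m, r, r', hrel⟩ := exists_integralRep_sub_holds c
  obtain ⟨a₁, ha₁, h1⟩ := cubeResolution_of_cubeNashNormalForm h₁ n r
  obtain ⟨a₂, ha₂, h2⟩ := cubeResolution_of_cubeNashNormalForm h₁ m r'
  refine ⟨a₁ - a₂, cubicalSpan.sub_mem ha₁ ha₂, ?_⟩
  have : c - (a₁ - a₂) = (c - (of r - of r')) + (of r - a₁) - (of r' - a₂) := by abel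
  rw [this]
  exact relations.sub_mem (relations.add_mem hrel h1) h2

/-- **THE ASSEMBLY.** Cube–Nash normal form (leaf 1), the localised cube kernel modulo the pencils (leaf 2)
and `[π]`-cancellation modulo the pencils (leaf 3) imply `PencilComplete`.
[cite: Ayoub2014, Rem. 12–13 and Conj. 7] [cite: KontsevichZagier2001, §1.2 and §4.1] -/
theorem pencilComplete_of_subs (h₁ : CubeNashNormalForm) (h₂ : CubicalPiLocalKernelModPencils)
    (h₃ : PiCancellationModPencils) : PencilComplete := by
  rw [pencilComplete_iff]
  intro n m ρ ρ' _ _ hv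
  -- the formal difference evaluates to zero
  have hc0 : eval (of ρ - of ρ') = 0 := by rw [eval_of_sub_of, hv, sub_self]
  -- a pinned disc-product operator exists (landed construction): no leaf is consumed vacuously
  obtain ⟨P, hP⟩ := exists_pinnedProduct
  -- leaf 1: reduce `[ρ] − [ρ']` to the cubical span
  obtain ⟨a, ha, hca⟩ := exists_cubical_of_cubeNashNormalForm h₁ (of ρ - of ρ')
  -- soundness: the cubical representative still evaluates to zero
  have ha0 : eval a = 0 := by
    have h := relations_le_ker_eval_holds hca
    rw [AddMonoidHom.mem_ker, map_sub, hc0, zero_sub, neg_eq_zero] at h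
    exact h
  -- leaf 2: some disc power of `a` lies in the pencil sector
  obtain ⟨N, hN⟩ := (cubicalPiLocalKernelModPencils_iff.mp h₂) P hP a ha ha0
  -- leaf 3: peel the disc factors
  have haS : a ∈ pencilSector :=
    mem_pencilSector_of_iterate_mem ((piCancellationModPencils_iff.mp h₃) P hP) N a hN
  -- conclude
  have : of ρ - of ρ' = (of ρ - of ρ' - a) + a := by abel
  rw [this]
  exact pencilSector.add_mem (relations_le_pencilSector hca) haS

/-! ## Honesty certificates -/

/-- Every generator of the pencil sector evaluates to `0`. [folklore] -/
theorem pencilSector_le_ker_eval : pencilSector ≤ eval.ker := by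
  refine sup_le (sup_le (fun c hc => relations_le_ker_eval_holds hc) ((AddSubgroup.closure_le _).mpr ?_))
    ((AddSubgroup.closure_le _).mpr ?_)
  · rintro d ⟨a, b, c, s, r, r', -, -, -, -, -, -, hval, rfl⟩
    rw [SetLike.mem_coe, AddMonoidHom.mem_ker, eval_of_sub_of, hval, sub_self]
  · rintro d ⟨s, r, r', -, -, -, -, -, hval, rfl⟩
    rw [SetLike.mem_coe, AddMonoidHom.mem_ker, eval_of_sub_of, hval, sub_self]

/-- **The summit implies the crux** (`relations ≤ pencilSector`). [folklore] -/
theorem pencilComplete_of_summit (hS : KontsevichZagierPeriods) : PencilComplete := by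
  rw [pencilComplete_iff]
  intro n m ρ ρ' hρ hρ' hv
  exact relations_le_pencilSector (hS ρ ρ' hρ hρ' hv)

/-- **Kernel form of the crux**: the rational shape is not load-bearing.
[cite: KontsevichZagier2001, §1.1 remark after the Definition] -/
theorem kernelForm_of_pencilComplete (h : PencilComplete) (c : FormalRep) (hc : eval c = 0) :
    c ∈ pencilSector := by
  obtain ⟨n, m, r, r', hrel⟩ := exists_integralRep_sub_holds c
  obtain ⟨N, R, hR, hrR⟩ := exists_isRational_equivalent_holds r
  obtain ⟨N', R', hR', hrR'⟩ := exists_isRational_equivalent_holds r'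
  have hv : r.value = r'.value := by
    have h0 : eval (c - (of r - of r')) = 0 := relations_le_ker_eval_holds hrel
    rw [map_sub, hc, zero_sub, neg_eq_zero, eval_of_sub_of, sub_eq_zero] at h0
    exact h0
  have hvR : R.value = R'.value := by
    rw [← Equivalent.value_eq_holds hrR, ← Equivalent.value_eq_holds hrR', hv]
  have hRR' : of R - of R' ∈ pencilSector := (pencilComplete_iff.mp h) R R' hR hR' hvR
  have h1 : of r - of R ∈ pencilSector := relations_le_pencilSector hrR
  have h2 : of r' - of R' ∈ pencilSector := relations_le_pencilSector hrR'
  have : c = (c - (of r - of r')) + (of r - of R) - (of r' - of R') + (of R - of R') := by abel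
  rw [this]
  exact pencilSector.add_mem (pencilSector.sub_mem (pencilSector.add_mem
    (relations_le_pencilSector hrel) h1) h2) hRR'

/-- **Crux ⇔ kernel form** `ker eval ≤ pencilSector`. [folklore] -/
theorem pencilComplete_iff_kernelForm :
    PencilComplete ↔ ∀ c : FormalRep, eval c = 0 → c ∈ pencilSector := by
  refine ⟨kernelForm_of_pencilComplete, fun h => ?_⟩
  rw [pencilComplete_iff]
  intro n m ρ ρ' _ _ hv
  exact h _ (by rw [eval_of_sub_of, hv, sub_self])

/-- `eval ∘ liftP P = π · eval` for a pinned operator (landed `piRep_mul_sub_lift_mem_relations` +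
`KZ.eval_piRep_mul`). [cite: KontsevichZagier2001, §4.1] -/
theorem eval_liftP {P : ∀ n : ℕ, IntegralRep n → IntegralRep (n + 2)}
    (hP : ∀ (n : ℕ) (r : IntegralRep n), (P n r).domain = {z : Fin (n + 2) → ℝ | z 0 ^ 2 + z 1 ^ 2 ≤ 1 ∧
        (fun i : Fin n => z i.succ.succ) ∈ r.domain} ∧
      (P n r).integrand = fun z => r.integrand (fun i : Fin n => z i.succ.succ))
    (c : FormalRep) : eval (liftP P c) = Real.pi * eval c := by
  have h0 : eval (of piRep * c - liftP P c) = 0 :=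
    relations_le_ker_eval_holds (piRep_mul_sub_lift_mem_relations P hP c)
  rw [map_sub, eval_piRep_mul, sub_eq_zero] at h0
  exact h0.symm

/-- **The crux implies leaf 3**: `liftP P c ∈ pencilSector ⇒ π · eval c = 0 ⇒ eval c = 0 ⇒ c ∈ pencilSector`.
[folklore] -/
theorem piCancellationModPencils_of_crux (h : PencilComplete) : PiCancellationModPencils := by
  rw [piCancellationModPencils_iff]
  intro P hP c hc
  have h0 : eval (liftP P c) = 0 := pencilSector_le_ker_eval hc
  rw [eval_liftP hP] at h0
  have hc0 : eval c = 0 := (mul_eq_zero.mp h0).resolve_left Real.pi_ne_zero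
  exact kernelForm_of_pencilComplete h c hc0

/-- **The crux implies leaf 2** (exponent `N = 0`). [folklore] -/
theorem cubicalPiLocalKernelModPencils_of_crux (h : PencilComplete) : CubicalPiLocalKernelModPencils := by
  rw [cubicalPiLocalKernelModPencils_iff]
  intro P _ a _ ha0
  exact ⟨0, kernelForm_of_pencilComplete h a ha0⟩

/-- **Exactness given the normal form**: under leaf 1, crux ⇔ leaf 2 ∧ leaf 3. [folklore] -/
theorem pencilComplete_iff_piSplit_of_cubeNash (h₁ : CubeNashNormalForm) :
    PencilComplete ↔ CubicalPiLocalKernelModPencils ∧ PiCancellationModPencils :=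
  ⟨fun h => ⟨cubicalPiLocalKernelModPencils_of_crux h, piCancellationModPencils_of_crux h⟩,
    fun h => pencilComplete_of_subs h₁ h.1 h.2⟩

end Summit.KontsevichZagierPeriods.KontsevichZagierPeriods.ZeroPortraitPencilCompleteSplit
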